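import Mathlib.AlgebraicGeometry.PullbackCarrier
import Mathlib.RingTheory.RingHom.Finite
import Mathlib.RingTheory.Artinian.Module
import Literature.AlgebraicGeometry.Resolution.PointBlowupHsFunMono
import HarnessLib

/-!
# Crux `NoZenoR` (stmt-ResolutionOfSingularities-19943) — points of a fibre product over a fixed PAIR of points form a
# finite set when one residue extension is finite (input of the rigidity half (D1) of the one-blow-up descent)

Route `ResolutionOfSingularities/HomologicalConductor` (cell decomp-res, hand leafhand-res-homologicalconduct-16 g3).
OURS: AI-written bookkeeping over Mathlib, weaker than expert review; nothing here is a statement of the manuscript under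
review (Hironaka 2017).  SUPPORT level, counted 0.  Def-free, no new named facts.

In the rigidity step (D1) of `…NoZenoRMinimalOfDescent` the closure of the graph of a morphism `h : Z' → X_r` contracting the
exceptional curve `E = τ⁻¹(z₁)` to a point `x₀` has, over `z₁`, only points of `Z₁ ×_S X_r` lying over the PAIR `(z₁, x₀)`;
these form a finite set because `z₁`, `x₀` are closed points (finite residue extensions), so that Zariski's Main Theorem
(`…NoZenoRProperBirationalFiniteFibres`) applies.  This file proves the finiteness:

* `finite_setOf_fst_eq_snd_eq` — for `f : X → S`, `g : Y → S`, `x ∈ X`, `y ∈ Y` over the same point of `S` with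
  `κ(g y) → κ(y)` finite, the set of points of `X ×_S Y` over `x` AND over `y` is finite: by Mathlib's description of the
  carrier of a fibre product (`Scheme.Pullback.carrierEquiv`) it is the image of `Spec (κ(x) ⊗_{κ(s)} κ(y))`, the
  spectrum of a finite `κ(x)`-algebra (base change of a finite map, `RingHom.finite_isStableUnderBaseChange`), i.e. of
  an Artinian ring;
* `finite_setOf_fst_eq_snd_eq_of_isClosed` — the same with `y` a CLOSED point and `g` locally of finite type
  (`finite_residueFieldMap_of_isClosed`, Stacks 01TB).

No crux or summit statement is proved here.
-/

noncomputable section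

-- single-problem summit: the doubled namespace component `ResolutionOfSingularities` is forced
set_option linter.dupNamespace false

open CategoryTheory CategoryTheory.Limits AlgebraicGeometry TopologicalSpace
open AlgebraicGeometry.Scheme.Pullback

universe u

namespace Summit.ResolutionOfSingularities.ResolutionOfSingularities.Theorems.NoZeno.ExcCount.FirstKind

/-- **The points of `X ×_S Y` over a fixed pair `(x, y)` form a finite set when `κ(g y) → κ(y)` is finite.**  They are
the image of `Spec (κ(x) ⊗_{κ(s)} κ(y))` (`Scheme.Pullback.carrierEquiv`), and `κ(x) → κ(x) ⊗_{κ(s)} κ(y)` is finite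
(base change of the finite `κ(s) → κ(y)`), so the tensor product is an Artinian ring with finitely many primes.
[cite: StacksProject, Tag 01JT]; [cite: EGAI, (3.4.9)] -/
theorem finite_setOf_fst_eq_snd_eq {X Y S : Scheme.{u}} (f : X ⟶ S) (g : Y ⟶ S) (x : X) (y : Y)
    (h : f.base x = g.base y) (hy : (g.residueFieldMap y).hom.Finite) :
    {t : ↑(pullback f g) | (pullback.fst f g).base t = x ∧ (pullback.snd f g).base t = y}.Finite := by
  let T : Triplet f g := Triplet.mk' x y h
  -- `κ(s) ≅ κ(g y) → κ(y)` is finite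
  have hgy : ((S.residueFieldCongr T.hy).inv ≫ g.residueFieldMap T.y).hom.Finite := by
    rw [CommRingCat.hom_comp]
    exact (RingHom.finite_respectsIso.cancel_left_isIso _ _).mpr hy
  -- hence so is `κ(x) → κ(x) ⊗_{κ(s)} κ(y)` (base change)
  have hinl : T.tensorInl.hom.Finite :=
    RingHom.IsStableUnderBaseChange.pushout_inl RingHom.finite_isStableUnderBaseChange
      RingHom.finite_respectsIso _ _ hgy
  -- so the tensor product is Artinian, with finite spectrum
  letI : Algebra (X.residueField T.x) T.tensor := T.tensorInl.hom.toAlgebra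
  haveI : Module.Finite (X.residueField T.x) T.tensor := hinl
  haveI : IsArtinianRing T.tensor := IsArtinianRing.of_finite (X.residueField T.x) T.tensor
  haveI : Finite (Spec T.tensor) := inferInstanceAs (Finite (PrimeSpectrum T.tensor))
  -- the points over `(x, y)` come from `Spec` of the tensor product
  refine (Set.finite_range fun p : Spec T.tensor => T.SpecTensorTo.base p).subset ?_
  rintro t ⟨htx, hty⟩
  have e : Triplet.ofPoint t = T := Triplet.ext htx hty
  refine ⟨(Spec.map (Triplet.tensorCongr e.symm).hom).base (SpecOfPoint t), ?_⟩
  change (Spec.map (Triplet.tensorCongr e.symm).hom ≫ T.SpecTensorTo).base (SpecOfPoint t) = t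
  rw [tensorCongr_SpecTensorTo e.symm]
  exact SpecTensorTo_SpecOfPoint t

/-- **The same over a CLOSED point `y` of a scheme locally of finite type over `S`**: closed points have finite residue
extensions (Stacks 01TB, tree `finite_residueFieldMap_of_isClosed`). [cite: StacksProject, Tag 01TB] -/
theorem finite_setOf_fst_eq_snd_eq_of_isClosed {X Y S : Scheme.{u}} (f : X ⟶ S) (g : Y ⟶ S)
    [LocallyOfFiniteType g] (x : X) {y : Y} (hyc : IsClosed ({y} : Set Y)) (h : f.base x = g.base y) :
    {t : ↑(pullback f g) | (pullback.fst f g).base t = x ∧ (pullback.snd f g).base t = y}.Finite :=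
  finite_setOf_fst_eq_snd_eq f g x y h
    (Literature.AlgebraicGeometry.Resolution.finite_residueFieldMap_of_isClosed g hyc)

end Summit.ResolutionOfSingularities.ResolutionOfSingularities.Theorems.NoZeno.ExcCount.FirstKind

end
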